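import Literature.IUT.HodgeArakelov.ThetaSettingModelTateProfiniteInnerAut
import Literature.IUT.HodgeArakelov.ThetaSettingModelTateExoticDatum
import HarnessLib

/-!
# The stage-2 Tate model is NOT normally terminal: the typed [SemiAnbd] Lem. 6.1 (iii)
# `TemperedCurve.PiTempNormallyTerminal` FAILS at `curveχq p i j` (kernel certificate for the MODEL-NT audit)

S. Mochizuki, *Semi-graphs of anabelioids*, Publ. RIMS **42** (2006) [SemiAnbd], Lemma 6.1 (iii) p. 69
(«`N_{Π_{X_K}}(Π^temp_{X_K}) = Π^temp_{X_K}`», print: [André] Cor. 6.2.2) [cite: MochizukiSemiAnbd2006, Lem 6.1(iii) p.69];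
[EtTh] §1 p. 12 [cite: MochizukiEtTh2009, §1 p.12].  Cell `abc-iut`, seat abc-iut-L6-d2 (gen 9), L6 ROWS #5 row R5-5
«MODEL-NT AUDIT» (abc-iut-L6-lead gen 8).  PROOF-ONLY.

THE STRUCTURAL FACT.  In every `Ẑ`-preimage model of the cell — tempered group `Π^tp := Γ ⋊ G` with
`Γ := ê⁻¹(ι ℤ) ⊆ F̂₂` the preimage of the discrete lattice `ι(ℤ) ⊆ Ẑ` under the continuous `a`-exponent `ê : F̂₂ → Ẑ`
(`Gfp`), completion `Π := F̂₂ ⋊ G` (`PiHtχq`, `toHatχq`) — the image of `Π^tp` in `Π` is a NORMAL subgroup (conjugation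
by `inl A`, any `A ∈ F̂₂`, preserves `ê` because `Ẑ` is abelian: `exists_profiniteInner`, p494839) and a PROPER one (`inl A`
with `ê(A) ∉ ι(ℤ)` is not in it: `exists_pow_not_mem_range_iotaZ`, p494727).  Hence its normaliser is all of `Π`:
* `range_toHatχq_normal`, `inl_not_mem_range_toHatχq`, `range_toHatχq_ne_top`;
* **`not_piTempNormallyTerminal_curveχq : ¬ (curveχq p i j).PiTempNormallyTerminal`** — for EVERY `p i j`, in particular
  at the tempered-curve layer of the Tate model of record `ThetaSetting.modelχq p 1 2` (`modelχq….toTemperedCurve = curveχq`).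
This is the ONE model artefact behind the K-L6 model-side failures booked tonight (huniq (R1) `not_huniq_modelTate` p495619,
(β1) / (H)(iii) one-`w` via `Ad(â^u)`, `N(Π^tp_{X̲̲}) ⊋ Π^tp_{X̲̲}`): print derives Rmk. 1.4.1 (ii)-type uniqueness from
normal/commensurable terminality ([SemiAnbd] Lem. 6.1, Thm. 6.4), which the tree proves for `TemperedCurve` data WITH a virtually
free non-abelian tower (`IsTempered.isCommensurablyTerminal_range`, hypothesis `htower₀`) — a tower no `ê`-preimage model has
(its open normal quotients are virtually cyclic).

HONEST FRAMING: a statement about OUR semi-synthetic model (consistency / binder-discharge evidence for OUR typed interface, not the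
tempered `π₁` of a curve); it says nothing about print's Lemma 6.1 (iii) for genuine curves; no side taken on [IUTchIII] Cor. 3.12;
typed ≠ proved; nothing asserts abc proved or refuted.
-/

set_option autoImplicit false

noncomputable section

namespace Literature.AnabelianGeometry.EtaleTheta.SettingModel

open Literature.AnabelianGeometry.SemiGraphs
open Function

variable (p : ℕ) [Fact p.Prime] (i j : ℤ)

/-- **The image of `Π^tp_X` in `Π_X = F̂₂ ⋊ G_{ℚ_p}` is a NORMAL subgroup** (stage-2 model, every `p i j`): `Π_X` is generated by
`inl F̂₂` and `inr G_{ℚ_p} ⊆ toHat(Π^tp_X)`, and `inl A` normalises the image by `exists_profiniteInner`.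
[cite: MochizukiSemiAnbd2006, Lem 6.1(iii) p.69] -/
theorem range_toHatχq_normal : (toHatχq p i j).toMonoidHom.range.Normal := by
  refine ⟨?_⟩
  rintro _ ⟨x, rfl⟩ c
  -- `c = inl c.left * inr c.right`
  obtain ⟨φ, hφ⟩ := exists_profiniteInner p i j c.left
  have hc : c = SemidirectProduct.inl c.left * SemidirectProduct.inr c.right := (SemidirectProduct.inl_left_mul_inr_right c).symm
  refine ⟨φ (SemidirectProduct.inr c.right * x * (SemidirectProduct.inr c.right)⁻¹), ?_⟩
  change toHatχq p i j (φ _) = c * toHatχq p i j x * c⁻¹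
  have hinr : toHatχq p i j (SemidirectProduct.inr c.right) = SemidirectProduct.inr c.right :=
    SemidirectProduct.ext (by rw [toHatχq_left, SemidirectProduct.left_inr, SemidirectProduct.left_inr, map_one])
      (by rw [toHatχq_right, SemidirectProduct.right_inr, SemidirectProduct.right_inr])
  rw [hφ, map_mul, map_mul, map_inv, hinr]
  conv_rhs => rw [hc]
  group

/-- `inl A ∉ toHat(Π^tp_X)` as soon as `ê(A) ∉ ι(ℤ)`. [cite: MochizukiEtTh2009, §1 p.12] -/
theorem inl_not_mem_range_toHatχq {A : F₂hatT} (hA : ∀ k : Multiplicative ℤ, eHat A ≠ iotaZ k) :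
    (SemidirectProduct.inl A : PiHtχq p i j) ∉ (toHatχq p i j).toMonoidHom.range := by
  rintro ⟨x, hx⟩
  have h := congrArg SemidirectProduct.left hx
  change (toHatχq p i j x).left = A at h
  rw [toHatχq_left, gfpFst_apply] at h
  exact hA _ (by rw [← h]; exact (mem_Gfp _).mp x.left.2)

/-- **The image of `Π^tp_X` in `Π_X` is PROPER** (`inl A`, `ê(A) ∉ ι(ℤ)`, is missed). [cite: MochizukiEtTh2009, §1 p.12] -/
theorem range_toHatχq_ne_top : (toHatχq p i j).toMonoidHom.range ≠ ⊤ := by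
  obtain ⟨v, hv⟩ := exists_pow_not_mem_range_iotaZ 1 one_ne_zero
  obtain ⟨-, -, hA⟩ := exoticDatum_props 1 v (by simpa using hv)
  intro h
  exact inl_not_mem_range_toHatχq p i j hA (h ▸ Subgroup.mem_top _)

/-- **The stage-2 Tate model is NOT normally terminal**: the typed [SemiAnbd] Lem. 6.1 (iii) predicate
`TemperedCurve.PiTempNormallyTerminal` FAILS at `curveχq p i j` (every `p i j`), i.e. at the tempered-curve layer of
`ThetaSetting.modelχq p i j` — `N_{Π_X}(Π^tp_X) = Π_X ≠ Π^tp_X`.  The single model artefact behind the K-L6 model-side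
failures of R5-5. [cite: MochizukiSemiAnbd2006, Lem 6.1(iii) p.69] -/
theorem not_piTempNormallyTerminal_curveχq : ¬ (curveχq p i j).PiTempNormallyTerminal := by
  intro h
  change Subgroup.normalizer ((toHatχq p i j).toMonoidHom.range : Set (PiHtχq p i j)) =
    (toHatχq p i j).toMonoidHom.range at h
  rw [Subgroup.normalizer_eq_top_iff.2 (range_toHatχq_normal p i j)] at h
  exact range_toHatχq_ne_top p i j h.symm

/-- The same at the Tate model of record `ThetaSetting.modelχq p i j hj` (its tempered-curve layer IS `curveχq p i j`).
[cite: MochizukiSemiAnbd2006, Lem 6.1(iii) p.69] -/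
theorem not_piTempNormallyTerminal_modelχq (hj : Even j) :
    ¬ (ThetaSetting.modelχq p i j hj).toTemperedCurve.PiTempNormallyTerminal :=
  not_piTempNormallyTerminal_curveχq p i j

end Literature.AnabelianGeometry.EtaleTheta.SettingModel

end
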